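import Summits.Schanuel.Schanuel.Theorems.SoloInformedAE2EventuallyA

/-!
# Theorem AE-2 (η = 0), asymptotic bookkeeping, part B

Soloist file (informed mode, seat `solo-Schanuel-informed`, s180).  Continuation of
`SoloInformedAE2EventuallyA`: the remaining explicit hypotheses of `soloAG_gelfond_input`
and the three comparisons with Gel'fond's sequences hold for all large `n` at the
parameters of THEOREM AE-2 (`x = n^μ`, `K = ⌊n^{σ-μ}⌋`, `t = ⌊n^τ/2⌋ + 1`,
`N = ⌊n^{1-μ+δ}⌋`, `Lg = n^{β-μ+δ}`, `V = n^ν/4`, `W = V K/(400 N)`):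

* `hA` (margin of Lemma T′; `soloAV_condA`), `hbud` (count of bad points; `soloAV_condB`),
* `h₅` (budget of THEOREM C at the root-count scale `N`; `soloAV_condD`) — the one place
  where `ν > 4 + β - 4σ - 4τ - μ + 5δ` is used,
* `h₆` (dilation losses; `soloAV_condE`),
* degree `< (n+1)^{e₁}`, type `< (n+1)^{e₂}`, and `40 a (n+1)^{e₁+e₂} < W/2`
  (`soloAV_condF`, `soloAV_condG`, `soloAV_condH`).

Each is a comparison `C · n^a ≤ n^b` with `a < b` plus `log y ≤ y^ε/ε` / `log y ≤ y - 1`; no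
number theory.  References: the seat's `paper/AE-note.md` §9; [Roy2010] D. Roy, Small value
estimates for the additive group, Int. J. Number Theory 6 (2010), arXiv:0708.2307.  Tree
files and Mathlib only; no definitions; axioms the standard three.
-/

namespace Summit.Schanuel.Schanuel.Theorems

open Filter

/-- `log(2 n^μ) ≤ 1 + log n` for `n ≥ 1`, `μ ≤ 1`. -/
theorem soloAV_log_two_mul_rpow {μ : ℝ} (hμ1 : μ ≤ 1) {n : ℕ} (hn : (1 : ℝ) ≤ n) :
    Real.log (2 * (n : ℝ) ^ μ) ≤ 1 + Real.log n := by
  have hn0 : (0 : ℝ) < n := by linarith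
  have hlogn : 0 ≤ Real.log n := Real.log_nonneg hn
  rw [Real.log_mul two_ne_zero (by positivity), Real.log_rpow hn0]
  have h2 := Real.log_two_lt_d9
  nlinarith

/-- Hypothesis `hA` of `soloAG_gelfond_input` (the margin of Lemma T′), eventually:
`n^τ log(2n^μ) + 4 n log(2 + K‖ξ‖) - n log(min 1 ‖ξ‖) ≤ 3 n^ν / 8`. -/
theorem soloAV_condA (ξ : ℂ) {σ τ ν μ : ℝ} (hμ0 : 0 < μ) (hμσ : μ < σ) (hσ1 : σ < 1)
    (hτν : τ < ν) (hν : 1 < ν) :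
    ∀ᶠ n : ℕ in atTop, (n : ℝ) ^ ν / 8 ≤
      ((n : ℝ) ^ ν - (n : ℝ) ^ τ * Real.log (2 * (n : ℝ) ^ μ)) - (n : ℝ) ^ ν / 2 -
        4 * n * Real.log (2 + ⌊(n : ℝ) ^ (σ - μ)⌋₊ * ‖ξ‖) + n * Real.log (min 1 ‖ξ‖) := by
  have hL0 : 0 ≤ Real.log (2 + ‖ξ‖) := Real.log_nonneg (by linarith [norm_nonneg ξ])
  have hκ0 : 0 < (ν - 1) / 2 := by linarith
  have hlt1 : 1 + (ν - 1) / 2 < ν := by linarith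
  have hε0 : 0 < (ν - τ) / 2 := by linarith
  have hlt2 : τ + (ν - τ) / 2 < ν := by linarith
  filter_upwards [soloT1_floor (sub_pos.mpr hμσ), eventually_const_mul_rpow_le_rpow hτν 16,
    eventually_const_mul_rpow_le_rpow hlt2 (16 / ((ν - τ) / 2)),
    eventually_const_mul_rpow_le_rpow hν (16 * (4 * Real.log (2 + ‖ξ‖) -
      Real.log (min 1 ‖ξ‖))),
    eventually_const_mul_rpow_le_rpow hlt1 (16 * (4 / ((ν - 1) / 2)))]
    with n ⟨hn1, _w1, hKle, _w2⟩ ha ha' hb hc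
  rw [Real.rpow_one] at hb
  have hn0 : (0 : ℝ) < n := by linarith
  have hKn : (⌊(n : ℝ) ^ (σ - μ)⌋₊ : ℝ) ≤ n := hKle.trans (by
    calc (n : ℝ) ^ (σ - μ) ≤ (n : ℝ) ^ (1 : ℝ) :=
          Real.rpow_le_rpow_of_exponent_le hn1 (by linarith)
      _ = n := Real.rpow_one _)
  have hK0 : (0 : ℝ) ≤ ⌊(n : ℝ) ^ (σ - μ)⌋₊ := Nat.cast_nonneg _
  have hlog : Real.log (2 + ⌊(n : ℝ) ^ (σ - μ)⌋₊ * ‖ξ‖) ≤ Real.log (2 + ‖ξ‖) + Real.log n := by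
    have h1 : 2 + ⌊(n : ℝ) ^ (σ - μ)⌋₊ * ‖ξ‖ ≤ (2 + ‖ξ‖) * n := by nlinarith [norm_nonneg ξ]
    calc Real.log (2 + ⌊(n : ℝ) ^ (σ - μ)⌋₊ * ‖ξ‖) ≤ Real.log ((2 + ‖ξ‖) * n) :=
          Real.log_le_log (by positivity) h1
      _ = Real.log (2 + ‖ξ‖) + Real.log n := by
          rw [Real.log_mul (by positivity) hn0.ne']
  have hlogn : Real.log n ≤ (n : ℝ) ^ ((ν - 1) / 2) / ((ν - 1) / 2) :=
    Real.log_le_rpow_div hn0.le hκ0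
  have hlogn' : Real.log n ≤ (n : ℝ) ^ ((ν - τ) / 2) / ((ν - τ) / 2) :=
    Real.log_le_rpow_div hn0.le hε0
  have e : (n : ℝ) * (n : ℝ) ^ ((ν - 1) / 2) = (n : ℝ) ^ (1 + (ν - 1) / 2) := by
    rw [Real.rpow_add hn0, Real.rpow_one]
  have e' : (n : ℝ) ^ τ * (n : ℝ) ^ ((ν - τ) / 2) = (n : ℝ) ^ (τ + (ν - τ) / 2) := by
    rw [Real.rpow_add hn0]
  have h4 : 4 * n * Real.log (2 + ⌊(n : ℝ) ^ (σ - μ)⌋₊ * ‖ξ‖) ≤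
      4 * Real.log (2 + ‖ξ‖) * n + 4 / ((ν - 1) / 2) * (n : ℝ) ^ (1 + (ν - 1) / 2) := by
    calc 4 * n * Real.log (2 + ⌊(n : ℝ) ^ (σ - μ)⌋₊ * ‖ξ‖)
        ≤ 4 * n * (Real.log (2 + ‖ξ‖) + (n : ℝ) ^ ((ν - 1) / 2) / ((ν - 1) / 2)) := by
          apply mul_le_mul_of_nonneg_left _ (by positivity)
          linarith
      _ = 4 * Real.log (2 + ‖ξ‖) * n +
          4 / ((ν - 1) / 2) * ((n : ℝ) * (n : ℝ) ^ ((ν - 1) / 2)) := by ring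
      _ = _ := by rw [e]
  have hτpos : 0 ≤ (n : ℝ) ^ τ := by positivity
  have h5 : (n : ℝ) ^ τ * Real.log (2 * (n : ℝ) ^ μ) ≤
      (n : ℝ) ^ τ + 1 / ((ν - τ) / 2) * (n : ℝ) ^ (τ + (ν - τ) / 2) := by
    have hl := soloAV_log_two_mul_rpow (μ := μ) (by linarith) hn1
    calc (n : ℝ) ^ τ * Real.log (2 * (n : ℝ) ^ μ)
        ≤ (n : ℝ) ^ τ * (1 + (n : ℝ) ^ ((ν - τ) / 2) / ((ν - τ) / 2)) :=
          mul_le_mul_of_nonneg_left (by linarith) hτpos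
      _ = (n : ℝ) ^ τ + 1 / ((ν - τ) / 2) * ((n : ℝ) ^ τ * (n : ℝ) ^ ((ν - τ) / 2)) := by
          ring
      _ = _ := by rw [e']
  have hν0 : 0 ≤ (n : ℝ) ^ ν := by positivity
  have ha'' : 1 / ((ν - τ) / 2) * (n : ℝ) ^ (τ + (ν - τ) / 2) ≤ (n : ℝ) ^ ν / 16 := by
    have := ha'
    have hε : (0 : ℝ) < (ν - τ) / 2 := hε0
    rw [show 16 / ((ν - τ) / 2) * (n : ℝ) ^ (τ + (ν - τ) / 2) =
      16 * (1 / ((ν - τ) / 2) * (n : ℝ) ^ (τ + (ν - τ) / 2)) by ring] at this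
    linarith
  linarith [ha, hb, hc, h4, h5, ha'']

/-- Hypothesis `hbud` of `soloAG_gelfond_input` (the count of bad points), eventually, when
`1 + β + μ < σ + τ + ν` (`β > 1`, `0 < μ ≤ 1`). -/
theorem soloAV_condB {β σ τ ν μ : ℝ} (hβ : 1 < β) (hμ0 : 0 < μ) (hμ1 : μ ≤ 1) (hμσ : μ < σ)
    (hτ0 : 0 ≤ τ) (h : 1 + β + μ < σ + τ + ν) :
    ∀ᶠ n : ℕ in atTop,
      200 * (10 * (n : ℝ) ^ 2 + 2 * n * (n * Real.log (2 * (n : ℝ) ^ μ) + (n : ℝ) ^ β)) ≤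
        ⌊(n : ℝ) ^ (σ - μ)⌋₊ * (((⌊(n : ℝ) ^ τ / 2⌋₊ + 1 : ℕ) : ℝ) * ((n : ℝ) ^ ν / 8)) := by
  have hε0 : 0 < (β - 1) / 2 := by linarith
  have hE1 : (2 : ℝ) < σ - μ + τ + ν := by linarith
  have hE2 : 2 + (β - 1) / 2 < σ - μ + τ + ν := by linarith
  have hE3 : 1 + β < σ - μ + τ + ν := by linarith
  filter_upwards [soloT1_floor (sub_pos.mpr hμσ), soloAV_tfloor hτ0,
    eventually_const_mul_rpow_le_rpow hE1 (96 * 2400),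
    eventually_const_mul_rpow_le_rpow hE2 (96 * (400 / ((β - 1) / 2))),
    eventually_const_mul_rpow_le_rpow hE3 (96 * 400)]
    with n ⟨hn1, _w3, _w4, hKge⟩ ⟨_w5, _w6, htge, _w7⟩ ha hb hc
  have hn0 : (0 : ℝ) < n := by linarith
  have h2 : (n : ℝ) ^ 2 = (n : ℝ) ^ (2 : ℝ) := by
    rw [show (2 : ℝ) = ((2 : ℕ) : ℝ) by norm_num, Real.rpow_natCast]
  have h3 : (n : ℝ) * (n : ℝ) ^ β = (n : ℝ) ^ (1 + β) := by
    rw [Real.rpow_add hn0, Real.rpow_one]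
  have h4 : (n : ℝ) ^ (2 : ℝ) * (n : ℝ) ^ ((β - 1) / 2) = (n : ℝ) ^ (2 + (β - 1) / 2) := by
    rw [Real.rpow_add hn0]
  have hlogn : Real.log n ≤ (n : ℝ) ^ ((β - 1) / 2) / ((β - 1) / 2) :=
    Real.log_le_rpow_div hn0.le hε0
  have hl : Real.log (2 * (n : ℝ) ^ μ) ≤ 1 + (n : ℝ) ^ ((β - 1) / 2) / ((β - 1) / 2) :=
    (soloAV_log_two_mul_rpow hμ1 hn1).trans (by linarith)
  have hl0 : 0 ≤ Real.log (2 * (n : ℝ) ^ μ) := by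
    have : (1 : ℝ) ≤ 2 * (n : ℝ) ^ μ := by
      have := Real.one_le_rpow hn1 hμ0.le
      linarith
    exact Real.log_nonneg this
  have hn2 : 0 ≤ (n : ℝ) ^ (2 : ℝ) := by positivity
  have hL : 200 * (10 * (n : ℝ) ^ 2 + 2 * n * (n * Real.log (2 * (n : ℝ) ^ μ) + (n : ℝ) ^ β)) ≤
      2400 * (n : ℝ) ^ (2 : ℝ) + 400 / ((β - 1) / 2) * (n : ℝ) ^ (2 + (β - 1) / 2) +
        400 * (n : ℝ) ^ (1 + β) := by
    rw [h2, ← h3, ← h4]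
    have hsq : (n : ℝ) * n = (n : ℝ) ^ (2 : ℝ) := by rw [← h2]; ring
    have hm : (n : ℝ) ^ (2 : ℝ) * Real.log (2 * (n : ℝ) ^ μ) ≤
        (n : ℝ) ^ (2 : ℝ) * (1 + (n : ℝ) ^ ((β - 1) / 2) / ((β - 1) / 2)) :=
      mul_le_mul_of_nonneg_left hl hn2
    calc 200 * (10 * (n : ℝ) ^ (2 : ℝ) + 2 * n * (n * Real.log (2 * (n : ℝ) ^ μ) + (n : ℝ) ^ β))
        = 2000 * (n : ℝ) ^ (2 : ℝ) + 400 * ((n : ℝ) * n * Real.log (2 * (n : ℝ) ^ μ)) +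
          400 * ((n : ℝ) * (n : ℝ) ^ β) := by ring
      _ = 2000 * (n : ℝ) ^ (2 : ℝ) + 400 * ((n : ℝ) ^ (2 : ℝ) * Real.log (2 * (n : ℝ) ^ μ)) +
          400 * ((n : ℝ) * (n : ℝ) ^ β) := by rw [hsq]
      _ ≤ 2000 * (n : ℝ) ^ (2 : ℝ) +
          400 * ((n : ℝ) ^ (2 : ℝ) * (1 + (n : ℝ) ^ ((β - 1) / 2) / ((β - 1) / 2))) +
          400 * ((n : ℝ) * (n : ℝ) ^ β) := by linarith
      _ = _ := by ring
  have hR : (n : ℝ) ^ (σ - μ + τ + ν) / 32 ≤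
      ⌊(n : ℝ) ^ (σ - μ)⌋₊ * (((⌊(n : ℝ) ^ τ / 2⌋₊ + 1 : ℕ) : ℝ) * ((n : ℝ) ^ ν / 8)) := by
    rw [Real.rpow_add hn0, Real.rpow_add hn0]
    calc (n : ℝ) ^ (σ - μ) * (n : ℝ) ^ τ * (n : ℝ) ^ ν / 32
        = ((n : ℝ) ^ (σ - μ) / 2) * (((n : ℝ) ^ τ / 2) * ((n : ℝ) ^ ν / 8)) := by ring
      _ ≤ _ := by gcongr
  linarith [ha, hb, hc]

/-- Hypothesis `h₅` of `soloAG_gelfond_input` (the budget of THEOREM C at the root-count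
scale), eventually — the one place where `ν > 4 + β - 4σ - 4τ - μ + 5δ` is used (as
`3 + β - 4μ + 4δ - 4τ < 4σ - 3μ + ν - 1 - δ`). -/
theorem soloAV_condD {β σ τ ν μ δ : ℝ} (hβ : 1 ≤ β) (hμσ : μ < σ) (hτ0 : 0 ≤ τ)
    (ha0 : 0 < 1 - μ + δ) (hν : 3 + β - 4 * μ + 4 * δ - 4 * τ < 4 * σ - 3 * μ + ν - 1 - δ) :
    ∀ᶠ n : ℕ in atTop,
      11000 * (2 * ((⌊(n : ℝ) ^ (1 - μ + δ)⌋₊ : ℝ) / ((⌊(n : ℝ) ^ τ / 2⌋₊ + 1 : ℕ) : ℝ)) ^ 3 *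
          (((⌊(n : ℝ) ^ (1 - μ + δ)⌋₊ : ℝ) / 2 + (n : ℝ) ^ (β - μ + δ)) /
            ((⌊(n : ℝ) ^ τ / 2⌋₊ + 1 : ℕ) : ℝ)) +
        2 * ((⌊(n : ℝ) ^ (1 - μ + δ)⌋₊ : ℝ) / ((⌊(n : ℝ) ^ τ / 2⌋₊ + 1 : ℕ) : ℝ)) ^ 4) ≤
      (⌊(n : ℝ) ^ (σ - μ)⌋₊ : ℝ) ^ 3 * ((n : ℝ) ^ ν / 4 * ⌊(n : ℝ) ^ (σ - μ)⌋₊ /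
        (800 * ⌊(n : ℝ) ^ (1 - μ + δ)⌋₊)) := by
  filter_upwards [soloT1_floor (sub_pos.mpr hμσ), soloAV_tfloor hτ0, soloT1_floor ha0,
    eventually_const_mul_rpow_le_rpow hν (11000 * 80 * 51200)]
    with n ⟨hn1, hK1, _w8, hKge⟩ ⟨_w9, _w10, htge, _w11⟩ ⟨_w12, hN1, hNle, _w13⟩ hc
  have hn0 : (0 : ℝ) < n := by linarith
  set t : ℝ := ((⌊(n : ℝ) ^ τ / 2⌋₊ + 1 : ℕ) : ℝ) with htdef
  set K : ℝ := (⌊(n : ℝ) ^ (σ - μ)⌋₊ : ℝ) with hKdef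
  set N : ℝ := (⌊(n : ℝ) ^ (1 - μ + δ)⌋₊ : ℝ) with hNdef
  have ht0 : 0 < t := by rw [htdef]; positivity
  have hK0 : 0 < K := by
    rw [hKdef]
    exact_mod_cast (show 0 < ⌊(n : ℝ) ^ (σ - μ)⌋₊ by omega)
  have hN0 : 0 < N := by
    rw [hNdef]
    exact_mod_cast (show 0 < ⌊(n : ℝ) ^ (1 - μ + δ)⌋₊ by omega)
  obtain ⟨hx, hy, -, -⟩ := soloAV_over (τ := τ) hβ hn1 ht0 htge hK0 hKge hNle
  have hx0 : 0 ≤ N / t := by positivity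
  -- the left side is at most `11000 · 80 · n^{3+β-4μ+4δ-4τ}`
  have e1 : ((n : ℝ) ^ (1 - μ + δ - τ)) ^ 3 * (n : ℝ) ^ (β - μ + δ - τ) =
      (n : ℝ) ^ (3 + β - 4 * μ + 4 * δ - 4 * τ) := by
    rw [soloTT_rpow_pow hn0.le, ← Real.rpow_add hn0]
    congr 1
    push_cast
    ring
  have e2 : ((n : ℝ) ^ (1 - μ + δ - τ)) ^ 4 ≤ (n : ℝ) ^ (3 + β - 4 * μ + 4 * δ - 4 * τ) := by
    rw [soloTT_rpow_pow hn0.le]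
    exact Real.rpow_le_rpow_of_exponent_le hn1 (by push_cast; linarith)
  have hx3 : (N / t) ^ 3 ≤ (2 * (n : ℝ) ^ (1 - μ + δ - τ)) ^ 3 := pow_le_pow_left₀ hx0 hx 3
  have hx4 : (N / t) ^ 4 ≤ (2 * (n : ℝ) ^ (1 - μ + δ - τ)) ^ 4 := pow_le_pow_left₀ hx0 hx 4
  have hp1 : 0 ≤ (n : ℝ) ^ (1 - μ + δ - τ) := by positivity
  have hp2 : 0 ≤ (n : ℝ) ^ (β - μ + δ - τ) := by positivity
  have hL : 11000 * (2 * (N / t) ^ 3 * ((N / 2 + (n : ℝ) ^ (β - μ + δ)) / t) +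
      2 * (N / t) ^ 4) ≤ 11000 * 80 * (n : ℝ) ^ (3 + β - 4 * μ + 4 * δ - 4 * τ) := by
    have h1 : (N / t) ^ 3 * ((N / 2 + (n : ℝ) ^ (β - μ + δ)) / t) ≤
        (2 * (n : ℝ) ^ (1 - μ + δ - τ)) ^ 3 * (3 * (n : ℝ) ^ (β - μ + δ - τ)) :=
      mul_le_mul hx3 hy (by positivity) (by positivity)
    have h1' : (2 * (n : ℝ) ^ (1 - μ + δ - τ)) ^ 3 * (3 * (n : ℝ) ^ (β - μ + δ - τ)) =
        24 * (n : ℝ) ^ (3 + β - 4 * μ + 4 * δ - 4 * τ) := by rw [← e1]; ring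
    have h2' : (2 * (n : ℝ) ^ (1 - μ + δ - τ)) ^ 4 = 16 * ((n : ℝ) ^ (1 - μ + δ - τ)) ^ 4 := by
      ring
    nlinarith [h1, h1', h2', hx4, e2]
  -- the right side is at least `n^{4σ-3μ+ν-1-δ} / 51200`
  have hR : (n : ℝ) ^ (4 * σ - 3 * μ + ν - 1 - δ) / 51200 ≤
      K ^ 3 * ((n : ℝ) ^ ν / 4 * K / (800 * N)) := by
    have hK4 : ((n : ℝ) ^ (σ - μ) / 2) ^ 4 ≤ K ^ 4 := pow_le_pow_left₀ (by positivity) hKge 4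
    have e3 : (n : ℝ) ^ (4 * σ - 3 * μ + ν - 1 - δ) =
        ((n : ℝ) ^ (σ - μ)) ^ 4 * (n : ℝ) ^ ν / (n : ℝ) ^ (1 - μ + δ) := by
      rw [soloTT_rpow_pow hn0.le, ← Real.rpow_add hn0, ← Real.rpow_sub hn0]
      congr 1
      push_cast
      ring
    rw [e3]
    have hν0 : 0 ≤ (n : ℝ) ^ ν := by positivity
    have hnum : 0 ≤ K ^ 4 * (n : ℝ) ^ ν := by positivity
    calc ((n : ℝ) ^ (σ - μ)) ^ 4 * (n : ℝ) ^ ν / (n : ℝ) ^ (1 - μ + δ) / 51200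
        = ((n : ℝ) ^ (σ - μ) / 2) ^ 4 * (n : ℝ) ^ ν / (3200 * (n : ℝ) ^ (1 - μ + δ)) := by
          field_simp
          ring
      _ ≤ K ^ 4 * (n : ℝ) ^ ν / (3200 * (n : ℝ) ^ (1 - μ + δ)) :=
          div_le_div_of_nonneg_right (mul_le_mul_of_nonneg_right hK4 hν0) (by positivity)
      _ ≤ K ^ 4 * (n : ℝ) ^ ν / (3200 * N) :=
          div_le_div_of_nonneg_left hnum (by positivity) (by linarith)
      _ = K ^ 3 * ((n : ℝ) ^ ν / 4 * K / (800 * N)) := by ring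
  linarith [hc]

/-- Hypothesis `h₆` of `soloAG_gelfond_input` (the dilation losses), eventually, when
`1 - τ + δ - μ < ν + σ - 1 - δ` and `β - σ - τ + δ < ν + σ - 1 - δ`. -/
theorem soloAV_condE (ξ : ℂ) {β σ τ ν μ δ : ℝ} (hβ : 1 ≤ β) (hμσ : μ < σ) (hτ0 : 0 ≤ τ)
    (ha0 : 0 < 1 - μ + δ) (hm1 : 1 - τ + δ - μ < ν + σ - 1 - δ)
    (hm2 : β - σ - τ + δ < ν + σ - 1 - δ) :
    ∀ᶠ n : ℕ in atTop,
      20 * ((⌊(n : ℝ) ^ (1 - μ + δ)⌋₊ : ℝ) / ((⌊(n : ℝ) ^ τ / 2⌋₊ + 1 : ℕ) : ℝ)) /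
            ⌊(n : ℝ) ^ (σ - μ)⌋₊ * Real.log (⌊(n : ℝ) ^ (σ - μ)⌋₊ * ‖ξ‖ + 1) +
        20 * ((((⌊(n : ℝ) ^ (1 - μ + δ)⌋₊ : ℝ) / 2 + (n : ℝ) ^ (β - μ + δ)) /
            ((⌊(n : ℝ) ^ τ / 2⌋₊ + 1 : ℕ) : ℝ))) / ⌊(n : ℝ) ^ (σ - μ)⌋₊ ≤
      (n : ℝ) ^ ν / 4 * ⌊(n : ℝ) ^ (σ - μ)⌋₊ / (400 * ⌊(n : ℝ) ^ (1 - μ + δ)⌋₊) / 2 := by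
  filter_upwards [soloT1_floor (sub_pos.mpr hμσ), soloAV_tfloor hτ0, soloT1_floor ha0,
    eventually_const_mul_rpow_le_rpow hm1 (12800 * (80 * ‖ξ‖)),
    eventually_const_mul_rpow_le_rpow hm2 (12800 * 120)]
    with n ⟨hn1, hK1, hKle, hKge⟩ ⟨_w14, _w15, htge, _w16⟩ ⟨_w17, hN1, hNle, _w18⟩ ha hb
  have hn0 : (0 : ℝ) < n := by linarith
  set t : ℝ := ((⌊(n : ℝ) ^ τ / 2⌋₊ + 1 : ℕ) : ℝ) with htdef
  set K : ℝ := (⌊(n : ℝ) ^ (σ - μ)⌋₊ : ℝ) with hKdef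
  set N : ℝ := (⌊(n : ℝ) ^ (1 - μ + δ)⌋₊ : ℝ) with hNdef
  have ht0 : 0 < t := by rw [htdef]; positivity
  have hK0 : 0 < K := by
    rw [hKdef]
    exact_mod_cast (show 0 < ⌊(n : ℝ) ^ (σ - μ)⌋₊ by omega)
  have hN0 : 0 < N := by
    rw [hNdef]
    exact_mod_cast (show 0 < ⌊(n : ℝ) ^ (1 - μ + δ)⌋₊ by omega)
  obtain ⟨-, -, hx, hy⟩ := soloAV_over (β := β) hβ hn1 ht0 htge hK0 hKge hNle
  obtain ⟨-, hW⟩ := soloAV_W_lower (ν := ν) hn1 hKge hN0 hNle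
  have hKξ : 0 ≤ K * ‖ξ‖ := mul_nonneg hK0.le (norm_nonneg ξ)
  have hlog0 : 0 ≤ Real.log (K * ‖ξ‖ + 1) := Real.log_nonneg (by linarith)
  have hlog : Real.log (K * ‖ξ‖ + 1) ≤ (n : ℝ) ^ (σ - μ) * ‖ξ‖ := by
    have h1 : Real.log (K * ‖ξ‖ + 1) ≤ K * ‖ξ‖ := by
      have := Real.add_one_le_exp (K * ‖ξ‖)
      exact (Real.log_le_iff_le_exp (by positivity)).mpr this
    exact h1.trans (mul_le_mul_of_nonneg_right hKle (norm_nonneg ξ))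
  have e : (n : ℝ) ^ (1 - σ - τ + δ) * (n : ℝ) ^ (σ - μ) = (n : ℝ) ^ (1 - τ + δ - μ) := by
    rw [← Real.rpow_add hn0]
    congr 1
    ring
  have h1 : 20 * (N / t) / K * Real.log (K * ‖ξ‖ + 1) ≤
      80 * ‖ξ‖ * (n : ℝ) ^ (1 - τ + δ - μ) := by
    calc 20 * (N / t) / K * Real.log (K * ‖ξ‖ + 1)
        ≤ 80 * (n : ℝ) ^ (1 - σ - τ + δ) * ((n : ℝ) ^ (σ - μ) * ‖ξ‖) :=
          mul_le_mul hx hlog hlog0 (by positivity)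
      _ = 80 * ‖ξ‖ * ((n : ℝ) ^ (1 - σ - τ + δ) * (n : ℝ) ^ (σ - μ)) := by ring
      _ = 80 * ‖ξ‖ * (n : ℝ) ^ (1 - τ + δ - μ) := by rw [e]
  linarith [ha, hb, h1, hy, hW]

/-- The degree bound against Gel'fond's sequence: `20 (N/t)/K < (n+1)^{e₁}` eventually when
`1 - σ - τ + δ < e₁` (`e₁ ≥ 0`). -/
theorem soloAV_condF {β σ τ μ δ e₁ : ℝ} (hβ : 1 ≤ β) (hμσ : μ < σ) (hτ0 : 0 ≤ τ)
    (ha0 : 0 < 1 - μ + δ) (he₁ : 0 ≤ e₁) (he : 1 - σ - τ + δ < e₁) :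
    ∀ᶠ n : ℕ in atTop,
      20 * ((⌊(n : ℝ) ^ (1 - μ + δ)⌋₊ : ℝ) / ((⌊(n : ℝ) ^ τ / 2⌋₊ + 1 : ℕ) : ℝ)) /
          ⌊(n : ℝ) ^ (σ - μ)⌋₊ < ((n : ℝ) + 1) ^ e₁ := by
  filter_upwards [soloT1_floor (sub_pos.mpr hμσ), soloAV_tfloor hτ0, soloT1_floor ha0,
    eventually_const_mul_rpow_le_rpow he 81]
    with n ⟨hn1, hK1, _w19, hKge⟩ ⟨_w20, _w21, htge, _w22⟩ ⟨_w23, _w24, hNle, _w25⟩ ha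
  have hn0 : (0 : ℝ) < n := by linarith
  have ht0 : (0 : ℝ) < ((⌊(n : ℝ) ^ τ / 2⌋₊ + 1 : ℕ) : ℝ) := by positivity
  have hK0 : (0 : ℝ) < ⌊(n : ℝ) ^ (σ - μ)⌋₊ := by
    exact_mod_cast (show 0 < ⌊(n : ℝ) ^ (σ - μ)⌋₊ by omega)
  obtain ⟨-, -, hx, -⟩ := soloAV_over (β := β) hβ hn1 ht0 htge hK0 hKge hNle
  have hpos : 0 < (n : ℝ) ^ (1 - σ - τ + δ) := by positivity
  have hmono : (n : ℝ) ^ e₁ ≤ ((n : ℝ) + 1) ^ e₁ :=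
    Real.rpow_le_rpow hn0.le (by linarith) he₁
  linarith

/-- The type bound against Gel'fond's sequence:
`20 (N/t)/K · (2 + log K) + 20 ((N/2 + Lg)/t)/K < (n+1)^{e₂}` eventually when
`1 - σ - τ + δ + κ/2 < e₂`, `β - σ - τ + δ < e₂` (`κ > 0`, `e₂ ≥ 0`, `σ - μ ≤ 1`). -/
theorem soloAV_condG {β σ τ μ δ κ e₂ : ℝ} (hβ : 1 ≤ β) (hμσ : μ < σ) (hσμ1 : σ - μ ≤ 1)
    (hτ0 : 0 ≤ τ) (ha0 : 0 < 1 - μ + δ) (hκ : 0 < κ) (he₂ : 0 ≤ e₂)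
    (he1 : 1 - σ - τ + δ + κ / 2 < e₂) (he2 : β - σ - τ + δ < e₂) :
    ∀ᶠ n : ℕ in atTop,
      20 * ((⌊(n : ℝ) ^ (1 - μ + δ)⌋₊ : ℝ) / ((⌊(n : ℝ) ^ τ / 2⌋₊ + 1 : ℕ) : ℝ)) /
            ⌊(n : ℝ) ^ (σ - μ)⌋₊ * (2 + Real.log ⌊(n : ℝ) ^ (σ - μ)⌋₊) +
        20 * ((((⌊(n : ℝ) ^ (1 - μ + δ)⌋₊ : ℝ) / 2 + (n : ℝ) ^ (β - μ + δ)) /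
            ((⌊(n : ℝ) ^ τ / 2⌋₊ + 1 : ℕ) : ℝ))) / ⌊(n : ℝ) ^ (σ - μ)⌋₊ <
        ((n : ℝ) + 1) ^ e₂ := by
  have he0 : 1 - σ - τ + δ < e₂ := by linarith
  have hκ2 : 0 < κ / 2 := by linarith
  filter_upwards [soloT1_floor (sub_pos.mpr hμσ), soloAV_tfloor hτ0, soloT1_floor ha0,
    eventually_const_mul_rpow_le_rpow he0 (4 * 160),
    eventually_const_mul_rpow_le_rpow he1 (4 * (80 / (κ / 2))),
    eventually_const_mul_rpow_le_rpow he2 (4 * 120)]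
    with n ⟨hn1, hK1, hKle, hKge⟩ ⟨_w26, _w27, htge, _w28⟩ ⟨_w29, _w30, hNle, _w31⟩ ha hb hc
  have hn0 : (0 : ℝ) < n := by linarith
  have ht0 : (0 : ℝ) < ((⌊(n : ℝ) ^ τ / 2⌋₊ + 1 : ℕ) : ℝ) := by positivity
  have hK0 : (0 : ℝ) < ⌊(n : ℝ) ^ (σ - μ)⌋₊ := by
    exact_mod_cast (show 0 < ⌊(n : ℝ) ^ (σ - μ)⌋₊ by omega)
  obtain ⟨-, -, hx, hy⟩ := soloAV_over (β := β) hβ hn1 ht0 htge hK0 hKge hNle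
  have hKn : (⌊(n : ℝ) ^ (σ - μ)⌋₊ : ℝ) ≤ n := hKle.trans (by
    calc (n : ℝ) ^ (σ - μ) ≤ (n : ℝ) ^ (1 : ℝ) := Real.rpow_le_rpow_of_exponent_le hn1 hσμ1
      _ = n := Real.rpow_one _)
  have hlogK : Real.log ⌊(n : ℝ) ^ (σ - μ)⌋₊ ≤ (n : ℝ) ^ (κ / 2) / (κ / 2) :=
    (Real.log_le_log hK0 hKn).trans (Real.log_le_rpow_div hn0.le hκ2)
  have hK1' : 1 ≤ ⌊(n : ℝ) ^ (σ - μ)⌋₊ := le_trans (by norm_num) hK1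
  have hlogK0 : 0 ≤ Real.log ⌊(n : ℝ) ^ (σ - μ)⌋₊ := Real.log_nonneg (by exact_mod_cast hK1')
  have e : (n : ℝ) ^ (1 - σ - τ + δ) * (n : ℝ) ^ (κ / 2) =
      (n : ℝ) ^ (1 - σ - τ + δ + κ / 2) := by
    rw [← Real.rpow_add hn0]
  have hpos : 0 < (n : ℝ) ^ (1 - σ - τ + δ) := by positivity
  have h1 : 20 * ((⌊(n : ℝ) ^ (1 - μ + δ)⌋₊ : ℝ) / ((⌊(n : ℝ) ^ τ / 2⌋₊ + 1 : ℕ) : ℝ)) /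
        ⌊(n : ℝ) ^ (σ - μ)⌋₊ * (2 + Real.log ⌊(n : ℝ) ^ (σ - μ)⌋₊) ≤
      160 * (n : ℝ) ^ (1 - σ - τ + δ) +
        80 / (κ / 2) * (n : ℝ) ^ (1 - σ - τ + δ + κ / 2) := by
    calc 20 * ((⌊(n : ℝ) ^ (1 - μ + δ)⌋₊ : ℝ) / ((⌊(n : ℝ) ^ τ / 2⌋₊ + 1 : ℕ) : ℝ)) /
          ⌊(n : ℝ) ^ (σ - μ)⌋₊ * (2 + Real.log ⌊(n : ℝ) ^ (σ - μ)⌋₊)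
        ≤ 80 * (n : ℝ) ^ (1 - σ - τ + δ) * (2 + (n : ℝ) ^ (κ / 2) / (κ / 2)) :=
          mul_le_mul hx (by linarith) (by positivity) (by positivity)
      _ = 160 * (n : ℝ) ^ (1 - σ - τ + δ) +
          80 / (κ / 2) * ((n : ℝ) ^ (1 - σ - τ + δ) * (n : ℝ) ^ (κ / 2)) := by ring
      _ = _ := by rw [e]
  have hmono : (n : ℝ) ^ e₂ ≤ ((n : ℝ) + 1) ^ e₂ :=
    Real.rpow_le_rpow hn0.le (by linarith) he₂
  linarith [ha, hb, hc, h1, hy]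

/-- The smallness against Gel'fond's product: `40 a (n+1)^{e₁} (n+1)^{e₂} < W/2` eventually
when `e₁ + e₂ < ν + σ - 1 - δ` (`e₁, e₂ ≥ 0`, `a > 0`). -/
theorem soloAV_condH {σ ν μ δ e₁ e₂ : ℝ} (hμσ : μ < σ) (ha0 : 0 < 1 - μ + δ) (he₁ : 0 ≤ e₁)
    (he₂ : 0 ≤ e₂) (hE : e₁ + e₂ < ν + σ - 1 - δ) {a : ℝ} (ha : 0 < a) :
    ∀ᶠ n : ℕ in atTop, 40 * a * ((n : ℝ) + 1) ^ e₁ * ((n : ℝ) + 1) ^ e₂ <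
      (n : ℝ) ^ ν / 4 * ⌊(n : ℝ) ^ (σ - μ)⌋₊ / (400 * ⌊(n : ℝ) ^ (1 - μ + δ)⌋₊) / 2 := by
  filter_upwards [soloT1_floor (sub_pos.mpr hμσ), soloT1_floor ha0,
    eventually_const_mul_rpow_le_rpow hE (6400 * (40 * a * (2 : ℝ) ^ e₁ * (2 : ℝ) ^ e₂) + 1)]
    with n ⟨hn1, _w32, _w33, hKge⟩ ⟨_w34, hN1, hNle, _w35⟩ h
  have hn0 : (0 : ℝ) < n := by linarith
  have hN0 : (0 : ℝ) < ⌊(n : ℝ) ^ (1 - μ + δ)⌋₊ := by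
    exact_mod_cast (show 0 < ⌊(n : ℝ) ^ (1 - μ + δ)⌋₊ by omega)
  obtain ⟨-, hW⟩ := soloAV_W_lower (ν := ν) hn1 hKge hN0 hNle
  have h1 : ((n : ℝ) + 1) ^ e₁ ≤ (2 : ℝ) ^ e₁ * (n : ℝ) ^ e₁ := by
    rw [← Real.mul_rpow (by norm_num) hn0.le]
    exact Real.rpow_le_rpow (by positivity) (by linarith) he₁
  have h2 : ((n : ℝ) + 1) ^ e₂ ≤ (2 : ℝ) ^ e₂ * (n : ℝ) ^ e₂ := by
    rw [← Real.mul_rpow (by norm_num) hn0.le]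
    exact Real.rpow_le_rpow (by positivity) (by linarith) he₂
  have hprod : 40 * a * ((n : ℝ) + 1) ^ e₁ * ((n : ℝ) + 1) ^ e₂ ≤
      40 * a * (2 : ℝ) ^ e₁ * (2 : ℝ) ^ e₂ * (n : ℝ) ^ (e₁ + e₂) := by
    rw [Real.rpow_add hn0]
    calc 40 * a * ((n : ℝ) + 1) ^ e₁ * ((n : ℝ) + 1) ^ e₂
        = 40 * a * (((n : ℝ) + 1) ^ e₁ * ((n : ℝ) + 1) ^ e₂) := by ring
      _ ≤ 40 * a * (((2 : ℝ) ^ e₁ * (n : ℝ) ^ e₁) * ((2 : ℝ) ^ e₂ * (n : ℝ) ^ e₂)) :=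
          mul_le_mul_of_nonneg_left (mul_le_mul h1 h2 (by positivity) (by positivity))
            (by positivity)
      _ = 40 * a * (2 : ℝ) ^ e₁ * (2 : ℝ) ^ e₂ * ((n : ℝ) ^ e₁ * (n : ℝ) ^ e₂) := by ring
  have hpos : 0 < (n : ℝ) ^ (e₁ + e₂) := by positivity
  have hC : 0 ≤ 40 * a * (2 : ℝ) ^ e₁ * (2 : ℝ) ^ e₂ := by positivity
  nlinarith

end Summit.Schanuel.Schanuel.Theorems
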